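import Summits.ResolutionOfSingularities.ResolutionOfSingularities.Theorems.FrobeniusClosingPatchingRelPerfectSliceOfEngine
import Summits.ResolutionOfSingularities.ResolutionOfSingularities.Theorems.FrobeniusClosingPatchingRelPerfectAtomicRoofEngine
import Summits.ResolutionOfSingularities.ResolutionOfSingularities.Theorems.FrobeniusClosingPatchingRelPerfectGeomAtomLeThree
import Summits.ResolutionOfSingularities.ResolutionOfSingularities.Theorems.FrobeniusClosingPatchingRelPerfectCJSBlowupFormat
import Summits.ResolutionOfSingularities.ResolutionOfSingularities.Theses.Valuative
import Literature.AlgebraicGeometry.Resolution.AlterationsStrong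
import Literature.AlgebraicGeometry.Resolution.Temkin2008Localization
import Literature.AlgebraicGeometry.Resolution.ResolutionOfComponents
import HarnessLib

/-!
# Crux `PatchingRel` (stmt-ResolutionOfSingularities-0642, twin of `PatchingRelPerfect` stmt-16161):
# CERTIFICATE — Zariski patching over ALL fields BY NAME from the printed inputs and ONE LOCAL statement

Routes `ResolutionOfSingularities/Valuative` (crux #3 `PatchingRel`, shared with `CyclicCovers` and
the patching step of ≈ 20 sibling routes) and `FrobeniusClosing` (crux #6 `PatchingRelPerfect`, the
perfect-field twin). [OURS · L1 W5.2] The twin `PatchingRel` = `∀ p prime, LUrel_p → ResolutionInChar p`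
(relative local uniformization along every valuation of every f.g. `K/k`, `k` ANY field of
characteristic `p`, implies resolution of every reduced separated finite-type scheme over every
such `k`) was left LINE-DEAD by its own chain (Cruxes/PatchingRel/LINE-STATUS.md: smallest honest
residual = GLOBAL statements — Liu + principalization in char `p` + regular-blow-up admissible
resolution). The all-dimensional atomic roof engine of the `PatchingRelPerfect` line
(`Theorems.stub_atomicRoofEngine`, ANY field) gives it the same LOCAL reduction as the perfect twin,
with Temkin-format atoms at ALL regular points (no perfect-residue-field closed-point stratum is
available over imperfect `k`, so the threshold is the printed one, dimension `3`):

`Valuative.PatchingRel` ⇐ Cossart–Piltant 2019 Thm. 1.1 / Prop. 4.4 + CJS 2020 (named facts) +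
`LocalDesingGeFour`: for every field `k` of characteristic `p`, every integral separated finite-type
`k`-scheme `N` with `¬ dim N ≤ 3`, every regular `y ∈ N` with `¬ dim 𝒪_{N,y} ≤ 3`, every integral
`T` proper and birational over `Spec 𝒪_{N,y}` and regular off the closed fibre admits a
desingularization (Temkin 2008, Def. 2.2.6). OPEN (it is resolution in dimension `≥ 4`, LOCAL
form); the GLOBALISATION is a theorem. CONDITIONAL; the item stays open.

## Sources

* O. Zariski, Ann. of Math. 45 (1944), Fundamental Theorem p. 539. [Zariski1944]
* O. Piltant, RACSAM 107 (2013), Prop. 5.1, Cor. 5.7, p. 2. [Piltant2013]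
* V. Cossart, O. Piltant, J. Algebra 529 (2019), Thm. 1.1, Prop. 4.4, proof of Prop. 4.6. [CossartPiltant2019]
* M. Temkin, Adv. Math. 219 (2008), Def. 2.2.6, Prop. 2.3.4. [Temkin2008]
-/

set_option linter.dupNamespace false -- single-problem summit: doubled namespace component is forced

noncomputable section

open CategoryTheory CategoryTheory.Limits AlgebraicGeometry Literature.AlgebraicGeometry.Resolution
open Literature.AlgebraicGeometry (Motives.projectiveSpace Motives.isProper_projectiveSpace
  Motives.IsProjectiveOver)
open TopologicalSpace IsLocalRing

namespace Summit.ResolutionOfSingularities.ResolutionOfSingularities.Theorems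

namespace PatchingRel.LocalDesing

variable {k K : Type} [Field k] [Field K] [Algebra k K]

/-- **Regular roofs with local desingularizations at EVERY point of a model dominating a resolving
system**, in dimension `m ≥ 4`, ANY field of characteristic `p`: if the proper model `N` of `K/k`, `trdeg_k K = m`, `¬ m ≤ 3`,
dominates every member of a finite list of proper models on SOME member of which every valuation
ring of `K/k` has a regular centre, then every point `x ∈ N` has a regular roof `q : N → M` — `x` is
the centre of a valuation ring `v` (`KModel.exists_isCentre_of_isGenericPoint`), regularly centred
on some member `M`, and the domination maps `x` to that centre (`ProperModel.Hom.map_centre`) — and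
the regular local rings of `M` carry local desingularizations: `dim M = m` (`dim = trdeg`), so at a
regular `y ∈ M` either `dim 𝒪_{M,y} ≤ 3` and the printed stratum `hP3` applies, or `hR` does.
[cite: Piltant2013, Prop. 5.1 and Cor. 5.7] -/
theorem exists_roof_localDesing {p : ℕ} [CharP k p]
    (hP3 : ∀ (N : Scheme.{0}) (gN : N ⟶ Spec (.of k)) [LocallyOfFiniteType gN] [IsIntegral N]
      (y : N), ringKrullDim (N.presheaf.stalk y) ≤ (3 : ℕ) →
      ∀ (T : Scheme.{0}) (h : T ⟶ Spec (N.presheaf.stalk y)), IsIntegral T → IsProper h →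
        IsBirational h → Scheme.AdmitsDesingularization T)
    (hR : ∀ (N : Scheme.{0}) (gN : N ⟶ Spec (.of k)) [IsSeparated gN] [LocallyOfFiniteType gN]
      [QuasiCompact gN] [IsIntegral N], ¬ topologicalKrullDim N ≤ 3 → ∀ y : N,
      IsRegularLocalRing (N.presheaf.stalk y) → ¬ ringKrullDim (N.presheaf.stalk y) ≤ (3 : ℕ) →
      ∀ (T : Scheme.{0}) (h : T ⟶ Spec (N.presheaf.stalk y)), IsIntegral T → IsProper h →
        IsBirational h →
        (∀ t : T, h.base t ≠ IsLocalRing.closedPoint (N.presheaf.stalk y) →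
          IsRegularLocalRing (T.presheaf.stalk t)) →
        Scheme.AdmitsDesingularization T)
    (N : ProperModel k K) {m : ℕ} (hK : Algebra.trdeg k K = (m : Cardinal)) (hm : ¬ m ≤ 3)
    (l : List (ProperModel k K)) (hhom : ∀ M ∈ l, Nonempty (N.Hom M))
    (hcov : ∀ v : ZariskiRiemannSpace k K, ∃ M ∈ l, M.RegCentre v) (x : N.X) :
    ∃ (N' : Scheme.{0}) (gN : N' ⟶ Spec (.of k)) (q : N.X ⟶ N'),
      IsSeparated gN ∧ LocallyOfFiniteType gN ∧ QuasiCompact gN ∧ IsIntegral N' ∧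
      q ≫ gN = N.π ∧ IsProper q ∧ IsBirational q ∧
      IsRegularLocalRing (N'.presheaf.stalk (q.base x)) ∧
      ∀ y : N', IsRegularLocalRing (N'.presheaf.stalk y) →
        ∀ (T : Scheme.{0}) (h : T ⟶ Spec (N'.presheaf.stalk y)), IsIntegral T → IsProper h →
          IsBirational h →
          (∀ t : T, h.base t ≠ IsLocalRing.closedPoint (N'.presheaf.stalk y) →
            IsRegularLocalRing (T.presheaf.stalk t)) →
          Scheme.AdmitsDesingularization T := by
  -- `x` is the centre of some valuation ring `v` of `K/k`
  have hgen : IsGenericPoint N.toKModel.genericPt (Set.univ : Set N.X) := by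
    rw [N.genericPt_eq']
    exact genericPoint_spec N.X
  obtain ⟨v, hv⟩ := N.toKModel.exists_isCentre_of_isGenericPoint hgen x
  -- `v` has a regular centre on some member `M`, dominated by `N`
  obtain ⟨M, hMl, hMv⟩ := hcov v
  obtain ⟨φ⟩ := hhom M hMl
  have hx : φ.f.base x = M.centre v := by
    rw [ProperModel.eq_centre_of_isCentre hv]
    exact φ.map_centre v
  -- `dim M = m ≥ 5`
  have hdimM : ¬ topologicalKrullDim M.X ≤ 3 := by
    rw [Pialt.OpenRange.properModel_topologicalKrullDim_eq_of_trdeg M hK]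
    exact_mod_cast hm
  refine ⟨M.X, M.π, φ.f, inferInstance, inferInstance, inferInstance, inferInstance, φ.f_π,
    inferInstance, φ.isBirational, ?_, fun y hy T h hT hh hbir hoff => ?_⟩
  · rw [hx]
    exact hMv
  · by_cases hd : ringKrullDim (M.X.presheaf.stalk y) ≤ (3 : ℕ)
    · exact hP3 M.X M.π y hd T h hT hh hbir
    · exact hR M.X M.π hdimM y hy hd T h hT hh hbir hoff

/-- **The projective integral case of the dimension-`≥ 4` slice (any field).** For any field `k` of
characteristic `p` with relative local uniformization (fibrewise shape `hLU`), the two local strata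
`hP3`/`hR` and the atomic roof engine `hE`, every integral closed subscheme `X ⊆ ℙⁿ_k` with
`¬ dim X ≤ 3` has a resolution. Zariski's setup verbatim as in
`SliceOfEngine.hasResolution_projective_of_dim_le_four`: affine chart `Spec A ∋ η`, `K = Frac A`,
`X` as the projective model `M₀`, `trdeg_k K = dim X = m`; a finite resolving system of proper
models from (LU); the iterated join `N` of `M₀` with the system has regular roofs with local
desingularizations at all points (`exists_roof_localDesing`), the engine resolves `N`, and the
resolution descends along the proper birational domination `N → X`.
[cite: Piltant2013, Prop. 5.1 and Cor. 5.7; Zariski1944, p. 539] -/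
theorem hasResolution_projective_of_dim_ge_four {p : ℕ} [CharP k p]
    (hLU : ∀ (K : Type) [Field K] [Algebra k K] (O : ValuationSubring K) (R : Subalgebra k K),
      R.FG → IsFractionRing R K → R.toSubring ≤ O.toSubring →
        ∃ (A : Subalgebra k K) (h : A.toSubring ≤ O.toSubring), R ≤ A ∧ A.FG ∧
          IsRegularLocalRing (Localization.AtPrime
            (Ideal.comap (Subring.inclusion h) (IsLocalRing.maximalIdeal O))))
    (hP3 : ∀ (N : Scheme.{0}) (gN : N ⟶ Spec (.of k)) [LocallyOfFiniteType gN] [IsIntegral N]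
      (y : N), ringKrullDim (N.presheaf.stalk y) ≤ (3 : ℕ) →
      ∀ (T : Scheme.{0}) (h : T ⟶ Spec (N.presheaf.stalk y)), IsIntegral T → IsProper h →
        IsBirational h → Scheme.AdmitsDesingularization T)
    (hR : ∀ (N : Scheme.{0}) (gN : N ⟶ Spec (.of k)) [IsSeparated gN] [LocallyOfFiniteType gN]
      [QuasiCompact gN] [IsIntegral N], ¬ topologicalKrullDim N ≤ 3 → ∀ y : N,
      IsRegularLocalRing (N.presheaf.stalk y) → ¬ ringKrullDim (N.presheaf.stalk y) ≤ (3 : ℕ) →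
      ∀ (T : Scheme.{0}) (h : T ⟶ Spec (N.presheaf.stalk y)), IsIntegral T → IsProper h →
        IsBirational h →
        (∀ t : T, h.base t ≠ IsLocalRing.closedPoint (N.presheaf.stalk y) →
          IsRegularLocalRing (T.presheaf.stalk t)) →
        Scheme.AdmitsDesingularization T)
    (hE : ∀ (M : Scheme.{0}) (g : M ⟶ Spec (.of k)) [IsSeparated g]
      [LocallyOfFiniteType g] [QuasiCompact g] [IsIntegral M],
      (∀ m : M, ∃ (N : Scheme.{0}) (gN : N ⟶ Spec (.of k)) (q : M ⟶ N),
        IsSeparated gN ∧ LocallyOfFiniteType gN ∧ QuasiCompact gN ∧ IsIntegral N ∧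
        q ≫ gN = g ∧ IsProper q ∧ IsBirational q ∧
        IsRegularLocalRing (N.presheaf.stalk (q.base m)) ∧
        ∀ y : N, IsRegularLocalRing (N.presheaf.stalk y) →
          ∀ (T : Scheme.{0}) (h : T ⟶ Spec (N.presheaf.stalk y)), IsIntegral T → IsProper h →
            IsBirational h →
            (∀ t : T, h.base t ≠ IsLocalRing.closedPoint (N.presheaf.stalk y) →
              IsRegularLocalRing (T.presheaf.stalk t)) →
            Scheme.AdmitsDesingularization T) →
      Scheme.HasResolution M)
    {n : ℕ} (X : Scheme.{0}) [IsIntegral X] (ι : X ⟶ (Motives.projectiveSpace n k).left)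
    [IsClosedImmersion ι] (hX : ¬ topologicalKrullDim X ≤ 3) :
    Scheme.HasResolution X := by
  classical
  -- adapted from `SliceOfEngine.hasResolution_projective_of_dim_le_four` (p170125)
  haveI : IsProper (Motives.projectiveSpace n k).hom := Motives.isProper_projectiveSpace n k
  let πX : X ⟶ Spec (.of k) := ι ≫ (Motives.projectiveSpace n k).hom
  have hproj : Motives.IsProjectiveOver (Over.mk πX) := ⟨n, Over.homMk ι rfl, ‹_›⟩
  haveI : LocallyOfFiniteType πX := inferInstance
  -- an affine chart `U = Spec A` of `X`
  obtain ⟨_, ⟨U', hU', rfl⟩, hηU, -⟩ := X.isBasis_affineOpens.exists_subset_of_mem_open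
    (Set.mem_univ (genericPoint X)) isOpen_univ
  let U : X.Opens := U'
  have hU : IsAffineOpen U := hU'
  haveI : IsAffine U := hU
  haveI : Nonempty U := ⟨⟨_, hηU⟩⟩
  let A : Type := Γ(U, ⊤)
  -- `A` is a finitely generated `k`-algebra
  let g : (U : Scheme.{0}) ⟶ Spec (.of k) := U.ι ≫ πX
  let ψ : k →+* A := g.appTop.hom.comp (Scheme.ΓSpecIso (.of k)).inv.hom
  have hψ : ψ.FiniteType := by
    have h1 : g.appTop.hom.FiniteType :=
      (HasRingHomProperty.iff_of_isAffine (P := @LocallyOfFiniteType)).mp inferInstance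
    exact h1.comp (RingHom.FiniteType.of_surjective _
      (Scheme.ΓSpecIso (.of k)).symm.commRingCatIsoToRingEquiv.surjective)
  letI : Algebra k A := ψ.toAlgebra
  haveI hft : Algebra.FiniteType k A := hψ
  -- its fraction field `K`, and `X` as a projective model of `K/k`
  let K : Type := FractionRing A
  let j : Spec (.of A) ⟶ X := U.toScheme.isoSpec.inv ≫ U.ι
  have hj : j ≫ πX = Spec.map (CommRingCat.ofHom (algebraMap k A)) := by
    change (U.toScheme.isoSpec.inv ≫ U.ι) ≫ πX = Spec.map (CommRingCat.ofHom ψ)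
    rw [Category.assoc, isoSpec_inv_comp]
    rfl
  let M₀ : ProjModel k K := ProjModel.ofChart (K := K) X πX hproj A j hj
  -- `A` as a subalgebra `A₀ ⊆ K`, finitely generated with `Frac A₀ = K`
  let toK : A →ₐ[k] K := IsScalarTower.toAlgHom k A K
  let A₀ : Subalgebra k K := toK.range
  have hA₀fg : A₀.FG := by
    rw [show A₀ = Subalgebra.map toK ⊤ from (Algebra.map_top toK).symm]
    exact Subalgebra.FG.map toK hft.out
  haveI hA₀fr : IsFractionRing A₀ K := by
    refine IsFractionRing.of_field A₀ K fun z => ?_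
    obtain ⟨a, b, -, rfl⟩ := IsFractionRing.div_surjective (A := A) z
    exact ⟨⟨algebraMap A K a, a, rfl⟩, ⟨algebraMap A K b, b, rfl⟩, rfl⟩
  -- `trdeg_k K` is a natural number `m`, `dim X = m`, so `¬ m ≤ 3`
  haveI : Algebra.FiniteType k A₀ := A₀.fg_iff_finiteType.mp hA₀fg
  obtain ⟨m, -, htrA₀⟩ := exists_ringKrullDim_eq_and_trdeg_eq k A₀
  have hKm : Algebra.trdeg k K = m := (trdeg_eq_trdeg_of_isFractionRing A₀).trans htrA₀
  have hXm : topologicalKrullDim X = m :=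
    Pialt.OpenRange.properModel_topologicalKrullDim_eq_of_trdeg M₀.toProperModel hKm
  have hm : ¬ m ≤ 3 := fun h => hX (by rw [hXm]; exact_mod_cast h)
  -- a finite resolving system of affine models, from (LU)
  have hcov : ∀ v : ZariskiRiemannSpace k K, ∃ T : Subalgebra k K,
      (T.FG ∧ IsFractionRing T K) ∧ ZariskiRiemannSpace.HasRegularCentre T v :=
    fun v => exists_hasRegularCentre_of_relLU (hLU K) A₀ hA₀fg v
  obtain ⟨𝒯, h𝒯, h𝒯cov⟩ := exists_finite_resolvingSystem' (P := fun T => IsFractionRing T K)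
    (fun T hT => (isJ2Ring_of_field k).2 T ((Subalgebra.fg_iff_finiteType T).mp hT)) hcov
  -- their projective closures, as PROPER models: a finite resolving system of proper models
  have hM : ∀ T : ↥𝒯, ∃ M : ProperModel k K, ∀ w : ZariskiRiemannSpace k K,
      ZariskiRiemannSpace.HasRegularCentre T.1 w → M.RegCentre w := fun T => by
    haveI := (h𝒯 T.1 T.2).2
    obtain ⟨M, hM⟩ := ProjModel.exists_regCentre_of_hasRegularCentre T.1 (h𝒯 T.1 T.2).1
    exact ⟨M.toProperModel, fun w hw => (M.toProperModel_regCentre_iff w).mpr (hM w hw)⟩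
  choose M hM using hM
  let l : List (ProperModel k K) := 𝒯.attach.toList.map M
  have hlcov : ∀ v : ZariskiRiemannSpace k K, ∃ N ∈ l, N.RegCentre v := by
    intro v
    obtain ⟨T, hT, hTv⟩ := h𝒯cov v
    refine ⟨M ⟨T, hT⟩, ?_, hM ⟨T, hT⟩ v hTv⟩
    exact List.mem_map.mpr ⟨⟨T, hT⟩, Finset.mem_toList.mpr (Finset.mem_attach _ _), rfl⟩
  -- the iterated join of `M₀` with the resolving system
  obtain ⟨N, φ₀, hN⟩ := PatchingRelPerfect.SliceOfEngine.exists_hom_forall_nonempty_hom M₀.toProperModel l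
  -- `N` has regular roofs with local desingularizations at all points: the engine resolves it
  have hresN : Scheme.HasResolution N.X :=
    hE N.X N.π fun x => exists_roof_localDesing hP3 hR N hKm hm l hN hlcov x
  -- transfer to `X = M₀.X` along the proper birational domination `N → M₀`
  have hres₀ : Scheme.HasResolution M₀.toProperModel.X :=
    Scheme.HasResolution.of_isBirational φ₀.f φ₀.isBirational hresN
  exact hres₀

end PatchingRel.LocalDesing

open PatchingRel.LocalDesing in
/-- **The twin crux `Valuative.PatchingRel` BY NAME (ALL fields of characteristic `p`) from the
printed dimension-`≤ 3` theorems and ONE LOCAL open statement** `hR` — punctual resolution in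
Temkin's format over the regular local rings of local dimension `≥ 4` of varieties of dimension
`≥ 4` over fields of characteristic `p`. PROOF: `ResolutionInChar p` is its integral case
(`resolutionInChar_iff_integral`); an integral `X` has `dim X ≤ n` for some `n`;
`ResolutionOverUpToDim k n` by `ResolutionOverUpToDim.of_projective`: projective integral `Y` of
dimension `≤ 3` by Cossart–Piltant (`hasResolution_of_dim_le_three`), the others by
`hasResolution_projective_of_dim_ge_four` — (LU) ⇒ finite resolving system ⇒ iterated join ⇒
regular roofs with local desingularizations at ALL points (printed stratum
`Theorems.stub_geomAtomLeThree` in local dimension `≤ 3`, `hR` above) ⇒ the atomic roof engine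
`Theorems.stub_atomicRoofEngine`. CONDITIONAL; the item stays open.
[cite: CossartPiltant2019, Thm. 1.1 and Prop. 4.4; CossartJannsenSaito2020, Thm. 1.2;
Temkin2008, Def. 2.2.6 and Prop. 2.3.4; Piltant2013, Prop. 5.1 and p. 2; Zariski1944, p. 539] -/
theorem valuativePatchingRel_of_printed_of_localDesingGeFour
    (hG : CossartPiltant2019General.{0}) (hP : CossartPiltant2019Principalization.{0})
    (hCJS : ∀ (X : Scheme.{0}) [IsNoetherian X] [IsReduced X], Scheme.IsExcellent X →
      topologicalKrullDim X ≤ 2 → Scheme.AdmitsDesingularization X)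
    (hR : ∀ (p : ℕ), p.Prime → ∀ (k : Type) [Field k] [CharP k p] (N : Scheme.{0})
      (gN : N ⟶ Spec (.of k)) [IsSeparated gN] [LocallyOfFiniteType gN] [QuasiCompact gN]
      [IsIntegral N], ¬ topologicalKrullDim N ≤ 3 → ∀ y : N,
      IsRegularLocalRing (N.presheaf.stalk y) → ¬ ringKrullDim (N.presheaf.stalk y) ≤ (3 : ℕ) →
      ∀ (T : Scheme.{0}) (h : T ⟶ Spec (N.presheaf.stalk y)), IsIntegral T → IsProper h →
        IsBirational h →
        (∀ t : T, h.base t ≠ IsLocalRing.closedPoint (N.presheaf.stalk y) →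
          IsRegularLocalRing (T.presheaf.stalk t)) →
        Scheme.AdmitsDesingularization T) :
    Summit.ResolutionOfSingularities.ResolutionOfSingularities.Theses.Valuative.PatchingRel := by
  intro p hp hLU
  have hCP : CossartPiltant2019.{0} := hG.cossartPiltant2019 Stacks07QW_field_holds
  rw [resolutionInChar_iff_integral]
  intro k _ _ X f hsep hft hqc hint
  haveI := hsep; haveI := hft; haveI := hqc; haveI := hint
  -- (LU) at `k`, in the fibrewise shape
  have hLU' : ∀ (K : Type) [Field K] [Algebra k K] (O : ValuationSubring K) (R : Subalgebra k K),
      R.FG → IsFractionRing R K → R.toSubring ≤ O.toSubring →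
        ∃ (A : Subalgebra k K) (h : A.toSubring ≤ O.toSubring), R ≤ A ∧ A.FG ∧
          IsRegularLocalRing (Localization.AtPrime
            (Ideal.comap (Subring.inclusion h) (IsLocalRing.maximalIdeal O))) := by
    intro K _ _ O R hRfg hRfr hRO
    haveI : Algebra.FiniteType k R := R.fg_iff_finiteType.mp hRfg
    haveI : Algebra.EssFiniteType R K :=
      Algebra.EssFiniteType.of_isLocalization K (nonZeroDivisors R)
    have hKfg : (⊤ : IntermediateField k K).FG :=
      IntermediateField.fg_top_iff.mpr (Algebra.EssFiniteType.comp k R K)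
    obtain ⟨A, h, hle, hAfg, -, hreg⟩ :=
      hLU k K hKfg O (fun c => hRO (R.algebraMap_mem c)) R hRfg hRO
    exact ⟨A, h, hle, hAfg, hreg⟩
  -- `X` is finite-dimensional
  haveI : CompactSpace X := QuasiCompact.compactSpace_of_compactSpace f
  obtain ⟨n, hn⟩ := exists_topologicalKrullDim_le_of_locallyOfFiniteType f
  -- weak resolution over `k` up to dimension `n`, by reduction to the projective integral case
  have hres : ResolutionOverUpToDim k n :=
    ResolutionOverUpToDim.of_projective fun N Y ι hι hint' hY => by
      haveI := hι
      haveI := hint'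
      by_cases hY3 : topologicalKrullDim Y ≤ 3
      · haveI : IsProper (Motives.projectiveSpace N k).hom := Motives.isProper_projectiveSpace N k
        haveI : IsReduced Y := inferInstance
        exact hasResolution_of_dim_le_three hCP k Y (ι ≫ (Motives.projectiveSpace N k).hom) hY3
      · exact hasResolution_projective_of_dim_ge_four hLU'
          (fun N' gN _ _ y hd T h hT hh hbir =>
            @stub_geomAtomLeThree hG hP hCJS k _ N' gN _ _ y hd T h hT hh hbir)
          (hR p hp k) (fun M g _ _ _ _ hroof => stub_atomicRoofEngine k M g hroof) Y ι hY3
  exact hres X f ‹_› ‹_› ‹_› inferInstance hn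

/-- The same with the CJS conjunct from the NAMED FACT `CossartJannsenSaito2020Sequence`: **the twin
crux `Valuative.PatchingRel` BY NAME from three named facts of the tree and ONE local open
statement.** CONDITIONAL. [cite: CossartPiltant2019, Thm. 1.1 and Prop. 4.4]
[cite: CossartJannsenSaito2020, Thm. 1.2] [cite: Temkin2008, Def. 2.2.6] -/
theorem valuativePatchingRel_of_namedFacts_of_localDesingGeFour
    (hG : CossartPiltant2019General.{0}) (hP : CossartPiltant2019Principalization.{0})
    (hS : CossartJannsenSaito2020Sequence.{0})
    (hR : ∀ (p : ℕ), p.Prime → ∀ (k : Type) [Field k] [CharP k p] (N : Scheme.{0})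
      (gN : N ⟶ Spec (.of k)) [IsSeparated gN] [LocallyOfFiniteType gN] [QuasiCompact gN]
      [IsIntegral N], ¬ topologicalKrullDim N ≤ 3 → ∀ y : N,
      IsRegularLocalRing (N.presheaf.stalk y) → ¬ ringKrullDim (N.presheaf.stalk y) ≤ (3 : ℕ) →
      ∀ (T : Scheme.{0}) (h : T ⟶ Spec (N.presheaf.stalk y)), IsIntegral T → IsProper h →
        IsBirational h →
        (∀ t : T, h.base t ≠ IsLocalRing.closedPoint (N.presheaf.stalk y) →
          IsRegularLocalRing (T.presheaf.stalk t)) →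
        Scheme.AdmitsDesingularization T) :
    Summit.ResolutionOfSingularities.ResolutionOfSingularities.Theses.Valuative.PatchingRel :=
  valuativePatchingRel_of_printed_of_localDesingGeFour hG hP
    (cjs2020BlowupFormat_of_cossartJannsenSaito2020Sequence hS) hR

end Summit.ResolutionOfSingularities.ResolutionOfSingularities.Theorems

end
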